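import Summits.BirchSwinnertonDyer.BirchSwinnertonDyer.Theorems.ByReductionTypeAtTwoAdditivePotGoodLowerHalfT0CoinvGenusRow315832c1
import Summits.BirchSwinnertonDyer.BirchSwinnertonDyer.Theorems.ByReductionTypeAtTwoFineSelmerConjAAtTwoAdditivePotGoodCoinvariantGenusCertificate9980Layers
import Summits.BirchSwinnertonDyer.BirchSwinnertonDyer.Theorems.ByReductionTypeAtTwoFineSelmerConjAAtTwoAdditivePotGoodCoinvariantGenusCertificate6453Layers
import Summits.BirchSwinnertonDyer.BirchSwinnertonDyer.Theorems.ByReductionTypeAtTwoFineSelmerConjAAtTwoAdditivePotGoodCoinvariantGenusCertificate733Layers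
import Summits.BirchSwinnertonDyer.BirchSwinnertonDyer.Theorems.ByReductionTypeAtTwoFineSelmerConjAAtTwoAdditivePotGoodCoinvariantGenusCertificate51992Layers
import Summits.BirchSwinnertonDyer.BirchSwinnertonDyer.Theorems.ByReductionTypeAtTwoFineSelmerConjAAtTwoAdditivePotGoodChevalleyOneBitDoor
import Summits.BirchSwinnertonDyer.BirchSwinnertonDyer.Theorems.ByReductionTypeAtTwoAdditivePotGoodLowerHalfT0NarrowRankStampsA
import Summits.BirchSwinnertonDyer.BirchSwinnertonDyer.Theorems.ByReductionTypeAtTwoAdditivePotGoodLowerHalfT0NarrowRankStampsB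
import Summits.BirchSwinnertonDyer.BirchSwinnertonDyer.Theorems.ByReductionTypeAtTwoAdditivePotGoodLowerHalfT0NarrowRankStampsC
import HarnessLib

/-!
# Route `ByReductionTypeAtTwo` (rung K4), crux C1″ `FineSelmerConjAAtTwoAdditivePotGood` (item stmt-BirchSwinnertonDyer-22615, cc C3″ 22617):
# CLASSICAL `μ₂ = 0` FOR THE CYCLOTOMIC `ℤ₂`-EXTENSIONS OF THE FOUR TOTALLY REAL CUBIC POINT FIELDS OF THE `Δ > 0` hLim2 ROWS
# `279440c1` (`d = 9980`), `293200be1` (`733`), `412992bw1` (`6453`), `467928d1` (`51992`) — KERNEL, by the COINVARIANT-GENUS road with ONE CUBIC unit each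
# (a `--supports 22615` file; seat `bsd-2adic-k4-w1` GEN 12; the generic assembly is k4-w2 GEN 14's p757388 §1 with the displayed unit supplied by name)

HONEST FRAMING (cell `bsd-2adic`, D-0036/D-0054/D-0152): KERNEL theorems about number fields (the μ-part of Greenberg's conjecture at `2` for four totally real
cubic fields); no elliptic-curve statement is proved here.  For these `Δ > 0` rows statement (A)₂ needs BOTH (a) classical `μ₂ = 0` (this file) AND (b) a bounded
narrow defect along the tower (`SteinbergFibreAtTwo.NarrowMu.conjA_two_cubicModel_of_narrowMu`); (b) stays the instrument letter EQUAL23.  Census-neutral; closes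
nothing at the `∀`-level; nothing booked; BSD is not proved by any of this.

THE ROAD (n₀ = 0, pair `(K₁, K₂) = (κ.layer 1, κ.layer 2)`, `c = 1`): `rank₂ Cl(K₁) ≤ 1` (`h(K) = 1` kernel certificates + `index_pow_two_mul_le_pow_of_odd_classNumber` +
at most two dyadic primes `ncard_primes_above_two_le_two`), `t ≤ 2` (`ncard_ramified_layer_succ_le_ncard_primes_above`), `r ≥ 1` from the landed KERNEL units
`exists_nonNorm_unit_layers_d{9980,733,6453,51992}` (cubic units `30411+4270θ−1162θ²`, `−5+2θ`, `−2−7θ−2θ²`, `−29−11θ−θ²`, non-norms at the degree-one dyadic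
prime: `u(r) ≡ ±3 (mod 8)`), `1 + 2 ≤ 1 + 1 + 1` ⟹ `classicalMuVanishes_of_rank_add_le_layer_succ_succ`.

* `classicalMuVanishes_of_odd_classNumber_of_nonNormUnit_g12` — the generic assembly (any `K` with `h(K)` odd, `≤ 2` primes above `2`, Fukuda index `0`, and
  the `hu/hnot` unit pair on `(K₁, K₂)`); private helpers copied from p757388 (they are private there).
* `classicalMuVanishes_h279440c1`, `_h293200be1`, `_h412992bw1`, `_h467928d1` — the four fields (for `467928d1` the `h = 1` certificate `…_root_d51992p` is read on
  its model `X³ − 50X − 104` through the root `(−66 − 7θ + θ²)/3`).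

References: [Washington1997] §13.1, §13.3 Prop. 13.22–13.23, Lemma 13.3; [Gras2003] IV.4; [Lang1990] Ch. 13 §4 Lemma 4.1; [Iwasawa1973MuInvariants] Thm. 2;
[Greenberg2001IwasawaPastPresent] Prop. 2.1 (context).
-/

set_option autoImplicit false
-- sibling precedent: the directory name repeats the summit name
set_option linter.dupNamespace false

noncomputable section

open scoped Classical IntermediateField NumberField Real nonZeroDivisors

namespace Summit.BirchSwinnertonDyer.BirchSwinnertonDyer.Theorems.AddKatoTwo

open WeierstrassCurve Field Polynomial IsDedekindDomain NumberField Literature.NumberTheory.EllipticCurves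
  Literature.NumberTheory.EllipticCurves.ZpExtension
  Literature.NumberTheory.GaloisRepresentations Literature.NumberTheory.GaloisRepresentations.Herbrand
  Literature.NumberTheory.GaloisRepresentations.MinkowskiUnit Literature.NumberTheory.GaloisRepresentations.CyclicNormIndex
  Literature.NumberTheory.IwasawaTheory Literature.NumberTheory.NumberFields Literature.NumberTheory.NumberFields.AmbiguousClass

/-- **`N : Cl(K_m) → Cl(K)` is onto for `m ≥ 1` when the Fukuda index is `0`**: a prime of `K_m` is totally ramified over `K` (its inertia group in
`Gal(K_m/K)` contains every automorphism, `ZpExtension.exists_isMaximal_forall_mem_inertia` at index `0`; `#I = e`), and a totally ramified prime makes the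
norm onto (`classGroupNorm_surjective_of_ramificationIdx_eq_finrank`). [cite: Washington1997, §13.1 Lemma 13.3 and Thm. 10.1] -/
private theorem classGroupNorm_layer_surjective_of_totallyRamifiedFrom_zero_g12 {F : Type} [Field F] [NumberField F]
    (κ : ZpExtension F 2) (hκ : TotallyRamifiedFrom κ 0) (m : ℕ) (hm : 0 < m) [NumberField (κ.layer m)] :
    Function.Surjective (classGroupNorm F (κ.layer m)) := by
  classical
  haveI : Fact (Nat.Prime 2) := ⟨Nat.prime_two⟩
  haveI : FiniteDimensional F (κ.layer m) := κ.finiteDimensional_layer_holds _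
  haveI : IsGalois F (κ.layer m) := κ.isGalois_layer_holds _
  obtain ⟨Q, hQmax, hQ⟩ := κ.exists_isMaximal_forall_mem_inertia hκ (n := 0) (m := m) le_rfl (Nat.zero_le _) hm
  haveI := hQmax
  have htop : Q.inertia ((κ.layer m) ≃ₐ[F] (κ.layer m)) = ⊤ := by
    refine top_le_iff.mp fun g _ => hQ g fun x hx => ?_
    rw [κ.layer_zero, IntermediateField.mem_bot] at hx
    obtain ⟨k, hk⟩ := hx
    have hx' : x = algebraMap F (κ.layer m) k := Subtype.ext hk.symm
    rw [hx', AlgEquiv.commutes]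
  haveI : (Q.under (𝓞 F)).IsMaximal := Ideal.IsMaximal.under (𝓞 F) Q
  have hcard := Ideal.card_inertia_eq_ramificationIdxIn (G := (κ.layer m) ≃ₐ[F] (κ.layer m)) (Q.under (𝓞 F)) Q
  rw [htop, Subgroup.card_top, Nat.card_eq_fintype_card, ← Nat.card_eq_fintype_card, IsGalois.card_aut_eq_finrank,
    Ideal.ramificationIdxIn_eq_ramificationIdx (Q.under (𝓞 F)) Q ((κ.layer m) ≃ₐ[F] (κ.layer m))] at hcard
  exact classGroupNorm_surjective_of_ramificationIdx_eq_finrank F (κ.layer m) Q hcard.symm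

/-- **The primes of `K` ramified in a layer `K_m` contain `p = 2`** (a `ℤ₂`-extension is unramified outside `2`, Washington Prop. 13.2,
`isUnramifiedAt_layer_of_natCast_not_mem_under`), so their number is at most `#{w ∋ 2}`. [cite: Washington1997, §13.1 Prop. 13.2] -/
private theorem ncard_ramified_layer_le_ncard_primes_above_g12 {F : Type} [Field F] [NumberField F]
    (κ : ZpExtension F 2) (m : ℕ) [NumberField (κ.layer m)] :
    {v : HeightOneSpectrum (𝓞 F) | v.asIdeal.ramificationIdxIn (𝓞 (κ.layer m)) ≠ 1}.ncard ≤
      {w : HeightOneSpectrum (𝓞 F) | ((2 : ℕ) : 𝓞 F) ∈ w.asIdeal}.ncard := by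
  classical
  haveI : Fact (Nat.Prime 2) := ⟨Nat.prime_two⟩
  haveI : FiniteDimensional F (κ.layer m) := κ.finiteDimensional_layer_holds _
  haveI : IsGalois F (κ.layer m) := κ.isGalois_layer_holds _
  have hp0 : (Ideal.span {((2 : ℕ) : 𝓞 F)} : Ideal (𝓞 F)) ≠ ⊥ := by
    rw [Ne, Ideal.span_singleton_eq_bot]; norm_num
  have hTfin : {w : HeightOneSpectrum (𝓞 F) | ((2 : ℕ) : 𝓞 F) ∈ w.asIdeal}.Finite := by
    refine (Ideal.finite_factors hp0).subset fun w hw => ?_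
    exact (Ideal.dvd_span_singleton).mpr hw
  refine Set.ncard_le_ncard (fun v hv => ?_) hTfin
  haveI : v.asIdeal.IsMaximal := v.isMaximal
  obtain ⟨Q, hQmax, hQv⟩ := Ideal.exists_maximal_ideal_liesOver_of_isIntegral (S := 𝓞 (κ.layer m)) v.asIdeal
  haveI := hQmax; haveI := hQv
  have he : Q.ramificationIdx (𝓞 F) ≠ 1 := by
    have hv' : v.asIdeal.ramificationIdxIn (𝓞 (κ.layer m)) ≠ 1 := hv
    rwa [Ideal.ramificationIdxIn_eq_ramificationIdx v.asIdeal Q ((κ.layer m) ≃ₐ[F] (κ.layer m))] at hv'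
  by_contra hnot
  have hnot' : ((2 : ℕ) : 𝓞 F) ∉ Q.under (𝓞 F) := by rwa [← hQv.over]
  haveI := κ.isUnramifiedAt_layer_of_natCast_not_mem_under m Q hnot'
  exact he (Ideal.ramificationIdx_eq_one_of_isUnramifiedAt (R := 𝓞 F) (p := Q))


set_option maxHeartbeats 800000 in
set_option synthInstance.maxHeartbeats 200000 in
/-- **The coinvariant-genus assembly (generic).**  `K` a number field with `h(K)` odd and at most two primes above `2`; `κ` a `ℤ₂`-extension with Fukuda index `0`;
layers `K₁ = κ.layer 1 ⊆ K₂ = κ.layer 2` (inclusion algebra structure); ASSUME a unit of `K₁` (inside `K₂ˣ`) outside `E_{K₂} ∩ N_{Gal(K₂/K₁)} K₂ˣ`.  Then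
`μ(κ) = 0`: `rank₂ Cl(K₁) ≤ 1` (genus bound with odd base class number; ramified primes of `K₁/K` lie over `2`), `t ≤ 2`, `r ≥ 1`, `1 + 2 ≤ 1 + 1 + 1`
(`classicalMuVanishes_of_rank_add_le_layer_succ_succ`).  Verbatim k4-w2 GEN 14's argument for `315832c1` (p757388 §1), stated for any such `K`.
[cite: Washington1997, §13.3 Prop. 13.22–13.23] [cite: Lang1990, Ch. 13 §4, Lemma 4.1] [cite: Gras2003, IV.4] -/
theorem classicalMuVanishes_of_odd_classNumber_of_nonNormUnit_g12 (K : Type) [Field K] [NumberField K]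
    (hodd : Odd (NumberField.classNumber K)) (htwo : {w : HeightOneSpectrum (𝓞 K) | ((2 : ℕ) : 𝓞 K) ∈ w.asIdeal}.ncard ≤ 2)
    (κL : ZpExtension K 2) (hκ0 : TotallyRamifiedFrom κL 0)
    (hunit : haveI : FiniteDimensional K (κL.layer (0 + 1)) := κL.finiteDimensional_layer_holds _
      haveI : FiniteDimensional K (κL.layer (0 + (1 + 1))) := κL.finiteDimensional_layer_holds _
      haveI : NumberField (κL.layer (0 + 1)) := NumberField.of_module_finite K (κL.layer (0 + 1))
      haveI : NumberField (κL.layer (0 + (1 + 1))) := NumberField.of_module_finite K (κL.layer (0 + (1 + 1)))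
      letI : Algebra (κL.layer (0 + 1)) (κL.layer (0 + (1 + 1))) := (IntermediateField.inclusion (κL.layer_mono (by omega))).toRingHom.toAlgebra
      ∃ u : ((κL.layer (0 + (1 + 1))))ˣ, u ∈ unitsE (κL.layer (0 + (1 + 1))) ⊓ (unitsIncl (κL.layer (0 + 1)) (κL.layer (0 + (1 + 1)))).range ∧
        u ∉ unitsE (κL.layer (0 + (1 + 1))) ⊓ (⊤ : Subgroup ((κL.layer (0 + (1 + 1))))ˣ).map (Herbrand.norm ((κL.layer (0 + (1 + 1))) ≃ₐ[(κL.layer (0 + 1))] (κL.layer (0 + (1 + 1)))))) :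
    ClassicalMuVanishes κL := by
  classical
  haveI : Fact (Nat.Prime 2) := ⟨Nat.prime_two⟩
  haveI : FiniteDimensional K (κL.layer (0 + 1)) := κL.finiteDimensional_layer_holds _
  haveI : FiniteDimensional K (κL.layer (0 + (1 + 1))) := κL.finiteDimensional_layer_holds _
  haveI : NumberField (κL.layer (0 + 1)) := NumberField.of_module_finite K (κL.layer (0 + 1))
  haveI : NumberField (κL.layer (0 + (1 + 1))) := NumberField.of_module_finite K (κL.layer (0 + (1 + 1)))
  haveI : IsGalois K (κL.layer (0 + 1)) := κL.isGalois_layer_holds _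
  haveI : IsUnramifiedAtInfinitePlaces K (κL.layer (0 + 1)) := κL.isUnramifiedAtInfinitePlaces_layer _
  have hML : κL.layer (0 + 1) ≤ κL.layer (0 + (1 + 1)) := κL.layer_mono (by omega)
  letI : Algebra (κL.layer (0 + 1)) (κL.layer (0 + (1 + 1))) := (IntermediateField.inclusion hML).toRingHom.toAlgebra
  haveI : IsScalarTower K (κL.layer (0 + 1)) (κL.layer (0 + (1 + 1))) := IsScalarTower.of_algebraMap_eq fun x => ((IntermediateField.inclusion hML).commutes x).symm
  haveI : FiniteDimensional (κL.layer (0 + 1)) (κL.layer (0 + (1 + 1))) := Module.Finite.of_restrictScalars_finite K (κL.layer (0 + 1)) (κL.layer (0 + (1 + 1)))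
  haveI : IsGalois (κL.layer (0 + 1)) (κL.layer (0 + (1 + 1))) := isGalois_layer_layer κL
  -- `k = 1`: `[Cl(K₁) : Cl(K₁)²] ≤ 2`
  have hdeg₁ : Module.finrank K (κL.layer (0 + 1)) = 2 := by rw [κL.finrank_layer_holds (0 + 1)]; norm_num
  have hN₁ := classGroupNorm_layer_surjective_of_totallyRamifiedFrom_zero_g12 κL hκ0 (0 + 1) (by norm_num)
  have hgen₁ := index_pow_two_mul_le_pow_of_odd_classNumber (K := K) (L := (κL.layer (0 + 1))) hdeg₁ hodd hN₁
  have ht₀ := (ncard_ramified_layer_le_ncard_primes_above_g12 κL (0 + 1)).trans htwo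
  have hU₁ : 0 < (unitsE (κL.layer (0 + 1)) ⊓ (⊤ : Subgroup ((κL.layer (0 + 1)))ˣ).map (Herbrand.norm ((κL.layer (0 + 1)) ≃ₐ[K] (κL.layer (0 + 1))))).relIndex
      (unitsE (κL.layer (0 + 1)) ⊓ (unitsIncl K (κL.layer (0 + 1))).range) := by
    haveI : IsCyclic ((κL.layer (0 + 1)) ≃ₐ[K] (κL.layer (0 + 1))) :=
      isCyclic_of_prime_card (p := 2) (by rw [IsGalois.card_aut_eq_finrank, hdeg₁])
    obtain ⟨σ, hσ⟩ := IsCyclic.exists_generator (α := (κL.layer (0 + 1)) ≃ₐ[K] (κL.layer (0 + 1)))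
    exact Nat.pos_of_ne_zero (relIndex_unitsNorm_ne_zero hσ).1
  have hk : (powMonoidHom 2 : ClassGroup (𝓞 (κL.layer (0 + 1))) →* ClassGroup (𝓞 (κL.layer (0 + 1)))).range.index ≤ 2 ^ 1 := by
    set X := (powMonoidHom 2 : ClassGroup (𝓞 (κL.layer (0 + 1))) →* ClassGroup (𝓞 (κL.layer (0 + 1)))).range.index
    set U := (unitsE (κL.layer (0 + 1)) ⊓ (⊤ : Subgroup ((κL.layer (0 + 1)))ˣ).map (Herbrand.norm ((κL.layer (0 + 1)) ≃ₐ[K] (κL.layer (0 + 1))))).relIndex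
      (unitsE (κL.layer (0 + 1)) ⊓ (unitsIncl K (κL.layer (0 + 1))).range)
    have h4 : X * 2 * U ≤ 2 ^ 2 :=
      hgen₁.trans (Nat.pow_le_pow_right (by norm_num) ht₀)
    have h5 : X * 2 ≤ 4 := by
      have : X * 2 * 1 ≤ X * 2 * U := Nat.mul_le_mul_left _ hU₁
      omega
    rw [pow_one]; omega
  -- `r = 1` from the displayed unit
  have hdeg : Module.finrank (κL.layer (0 + 1)) (κL.layer (0 + (1 + 1))) = 2 := by
    rw [finrank_layer_layer κL (show 0 + 1 ≤ 0 + (1 + 1) by omega)]; norm_num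
  obtain ⟨u, hu, hnot⟩ := hunit
  have hr : 2 ^ 1 ∣ (unitsE (κL.layer (0 + (1 + 1))) ⊓ (⊤ : Subgroup ((κL.layer (0 + (1 + 1))))ˣ).map (Herbrand.norm ((κL.layer (0 + (1 + 1))) ≃ₐ[(κL.layer (0 + 1))] (κL.layer (0 + (1 + 1)))))).relIndex
      (unitsE (κL.layer (0 + (1 + 1))) ⊓ (unitsIncl (κL.layer (0 + 1)) (κL.layer (0 + (1 + 1)))).range) := by
    rw [pow_one]; exact two_dvd_relIndex_of_nonNorm hdeg hu hnot
  -- `t ≤ 2` (the bound is stated for the pair `(K_{0+1}, K_{0+1+1})`; the layers `K_{0+1+1}` and `K_{0+(1+1)}` agree definitionally)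
  have ht2 : {v : HeightOneSpectrum (𝓞 (κL.layer (0 + 1))) | v.asIdeal.ramificationIdxIn (𝓞 (κL.layer (0 + (1 + 1)))) ≠ 1}.ncard ≤ 2 := by
    have := (ncard_ramified_layer_succ_le_ncard_primes_above κL hκ0 (0 + 1)).trans htwo
    exact this
  have ht : 1 + {v : HeightOneSpectrum (𝓞 (κL.layer (0 + 1))) | v.asIdeal.ramificationIdxIn (𝓞 (κL.layer (0 + (1 + 1)))) ≠ 1}.ncard ≤ 1 + 1 + 1 := by
    omega
  exact (classicalMuVanishes_of_rank_add_le_layer_succ_succ κL hκ0 (c := 1) (k := 1) (r := 1) (by norm_num) hk hr ht).2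

set_option maxHeartbeats 1600000 in
set_option synthInstance.maxHeartbeats 200000 in
/-- **Classical `μ₂ = 0` along every cyclotomic `ℤ₂`-extension of the cubic point field of `279440c1`** (`θ` any root of
`X³ + (-1)X² + (-36)X + (-70)`, totally real): KERNEL — `h = 1`, `n₀ = 0`, at most two dyadic primes, and the CUBIC non-norm unit of
`exists_nonNorm_unit_layers_d9980`, through the coinvariant-genus criterion.  This is the μ-part of Greenberg's conjecture for this field at `p = 2`
and input (a) of `SteinbergFibreAtTwo.NarrowMu.conjA_two_cubicModel_of_narrowMu` for `279440c1` (input (b) is NOT provided here).  BSD for `279440c1` is NOT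
proved by this. [cite: Washington1997, §13.3 Prop. 13.22–13.23] [cite: Gras2003, IV.4] [cite: Iwasawa1973MuInvariants, Thm. 2] -/
theorem classicalMuVanishes_h279440c1
    {θ : AlgebraicClosure ℚ} (hθ : aeval θ (Cubic.toPoly ⟨1, ((-1 : ℤ) : ℚ), ((-36 : ℤ) : ℚ), ((-70 : ℤ) : ℚ)⟩) = 0) :
    haveI : FiniteDimensional ℚ (IntermediateField.adjoin ℚ {θ}) :=
      IntermediateField.adjoin.finiteDimensional ((AlgebraicClosure.isAlgebraic ℚ).isAlgebraic θ).isIntegral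
    haveI : NumberField (IntermediateField.adjoin ℚ {θ}) := NumberField.mk
    ∀ κL : ZpExtension (IntermediateField.adjoin ℚ {θ}) 2, κL.IsCyclotomic → ClassicalMuVanishes κL := by
  haveI : FiniteDimensional ℚ (IntermediateField.adjoin ℚ {θ}) :=
    IntermediateField.adjoin.finiteDimensional ((AlgebraicClosure.isAlgebraic ℚ).isAlgebraic θ).isIntegral
  haveI : NumberField (IntermediateField.adjoin ℚ {θ}) := NumberField.mk
  haveI : Fact (Nat.Prime 2) := ⟨Nat.prime_two⟩
  intro κL hκL
  have hirr := irreducible_cubic_d9980p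
  have h3 := finrank_adjoin_eq_three_of_irreducible hirr hθ
  obtain ⟨B, -, hB⟩ := exists_ringOfIntegers_cubic_root (p := -1) (q := -36) (r := -70) hθ
  have hh1 : NumberField.classNumber (IntermediateField.adjoin ℚ {θ}) = 1 := by
    exact classNumber_eq_one_of_root_d9980 (IntermediateField.adjoin ℚ {θ}) h3 B hB
  have hodd : Odd (NumberField.classNumber (IntermediateField.adjoin ℚ {θ})) := by rw [hh1]; exact odd_one
  have htwo := ncard_primes_above_two_le_two (IntermediateField.adjoin ℚ {θ}) h3 B hirr hB ⟨0, by norm_num⟩ ⟨0, by norm_num⟩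
  refine classicalMuVanishes_of_odd_classNumber_of_nonNormUnit_g12 (IntermediateField.adjoin ℚ {θ}) hodd htwo κL (forall_totallyRamifiedFrom_zero_h279440c1 hθ κL hκL) ?_
  haveI : FiniteDimensional (IntermediateField.adjoin ℚ {θ}) (κL.layer (0 + 1)) := κL.finiteDimensional_layer_holds _
  haveI : FiniteDimensional (IntermediateField.adjoin ℚ {θ}) (κL.layer (0 + (1 + 1))) := κL.finiteDimensional_layer_holds _
  haveI : NumberField (κL.layer (0 + 1)) := NumberField.of_module_finite (IntermediateField.adjoin ℚ {θ}) (κL.layer (0 + 1))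
  haveI : NumberField (κL.layer (0 + (1 + 1))) := NumberField.of_module_finite (IntermediateField.adjoin ℚ {θ}) (κL.layer (0 + (1 + 1)))
  have hML : κL.layer (0 + 1) ≤ κL.layer (0 + (1 + 1)) := κL.layer_mono (by omega)
  letI : Algebra (κL.layer (0 + 1)) (κL.layer (0 + (1 + 1))) := (IntermediateField.inclusion hML).toRingHom.toAlgebra
  haveI : IsScalarTower (IntermediateField.adjoin ℚ {θ}) (κL.layer (0 + 1)) (κL.layer (0 + (1 + 1))) :=
    IsScalarTower.of_algebraMap_eq fun x => ((IntermediateField.inclusion hML).commutes x).symm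
  exact exists_nonNorm_unit_layers_d9980 (IntermediateField.adjoin ℚ {θ}) h3 B hB κL hκL

set_option maxHeartbeats 1600000 in
set_option synthInstance.maxHeartbeats 200000 in
/-- **Classical `μ₂ = 0` along every cyclotomic `ℤ₂`-extension of the cubic point field of `293200be1`** (`θ` any root of
`X³ + (-1)X² + (-7)X + (8)`, totally real): KERNEL — `h = 1`, `n₀ = 0`, at most two dyadic primes, and the CUBIC non-norm unit of
`exists_nonNorm_unit_layers_d733`, through the coinvariant-genus criterion.  This is the μ-part of Greenberg's conjecture for this field at `p = 2`
and input (a) of `SteinbergFibreAtTwo.NarrowMu.conjA_two_cubicModel_of_narrowMu` for `293200be1` (input (b) is NOT provided here).  BSD for `293200be1` is NOT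
proved by this. [cite: Washington1997, §13.3 Prop. 13.22–13.23] [cite: Gras2003, IV.4] [cite: Iwasawa1973MuInvariants, Thm. 2] -/
theorem classicalMuVanishes_h293200be1
    {θ : AlgebraicClosure ℚ} (hθ : aeval θ (Cubic.toPoly ⟨1, ((-1 : ℤ) : ℚ), ((-7 : ℤ) : ℚ), ((8 : ℤ) : ℚ)⟩) = 0) :
    haveI : FiniteDimensional ℚ (IntermediateField.adjoin ℚ {θ}) :=
      IntermediateField.adjoin.finiteDimensional ((AlgebraicClosure.isAlgebraic ℚ).isAlgebraic θ).isIntegral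
    haveI : NumberField (IntermediateField.adjoin ℚ {θ}) := NumberField.mk
    ∀ κL : ZpExtension (IntermediateField.adjoin ℚ {θ}) 2, κL.IsCyclotomic → ClassicalMuVanishes κL := by
  haveI : FiniteDimensional ℚ (IntermediateField.adjoin ℚ {θ}) :=
    IntermediateField.adjoin.finiteDimensional ((AlgebraicClosure.isAlgebraic ℚ).isAlgebraic θ).isIntegral
  haveI : NumberField (IntermediateField.adjoin ℚ {θ}) := NumberField.mk
  haveI : Fact (Nat.Prime 2) := ⟨Nat.prime_two⟩
  intro κL hκL
  have hirr := irreducible_cubic_disc_733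
  have h3 := finrank_adjoin_eq_three_of_irreducible hirr hθ
  obtain ⟨B, -, hB⟩ := exists_ringOfIntegers_cubic_root (p := -1) (q := -7) (r := 8) hθ
  have hh1 : NumberField.classNumber (IntermediateField.adjoin ℚ {θ}) = 1 := by
    exact classNumber_eq_one_of_root_disc_733 (IntermediateField.adjoin ℚ {θ}) h3 B hB
  have hodd : Odd (NumberField.classNumber (IntermediateField.adjoin ℚ {θ})) := by rw [hh1]; exact odd_one
  have htwo := ncard_primes_above_two_le_two (IntermediateField.adjoin ℚ {θ}) h3 B hirr hB ⟨1, by norm_num⟩ ⟨0, by norm_num⟩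
  refine classicalMuVanishes_of_odd_classNumber_of_nonNormUnit_g12 (IntermediateField.adjoin ℚ {θ}) hodd htwo κL (forall_totallyRamifiedFrom_zero_h293200be1 hθ κL hκL) ?_
  haveI : FiniteDimensional (IntermediateField.adjoin ℚ {θ}) (κL.layer (0 + 1)) := κL.finiteDimensional_layer_holds _
  haveI : FiniteDimensional (IntermediateField.adjoin ℚ {θ}) (κL.layer (0 + (1 + 1))) := κL.finiteDimensional_layer_holds _
  haveI : NumberField (κL.layer (0 + 1)) := NumberField.of_module_finite (IntermediateField.adjoin ℚ {θ}) (κL.layer (0 + 1))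
  haveI : NumberField (κL.layer (0 + (1 + 1))) := NumberField.of_module_finite (IntermediateField.adjoin ℚ {θ}) (κL.layer (0 + (1 + 1)))
  have hML : κL.layer (0 + 1) ≤ κL.layer (0 + (1 + 1)) := κL.layer_mono (by omega)
  letI : Algebra (κL.layer (0 + 1)) (κL.layer (0 + (1 + 1))) := (IntermediateField.inclusion hML).toRingHom.toAlgebra
  haveI : IsScalarTower (IntermediateField.adjoin ℚ {θ}) (κL.layer (0 + 1)) (κL.layer (0 + (1 + 1))) :=
    IsScalarTower.of_algebraMap_eq fun x => ((IntermediateField.inclusion hML).commutes x).symm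
  exact exists_nonNorm_unit_layers_d733 (IntermediateField.adjoin ℚ {θ}) h3 B hB κL hκL

set_option maxHeartbeats 1600000 in
set_option synthInstance.maxHeartbeats 200000 in
/-- **Classical `μ₂ = 0` along every cyclotomic `ℤ₂`-extension of the cubic point field of `412992bw1`** (`θ` any root of
`X³ + (0)X² + (-18)X + (-25)`, totally real): KERNEL — `h = 1`, `n₀ = 0`, at most two dyadic primes, and the CUBIC non-norm unit of
`exists_nonNorm_unit_layers_d6453`, through the coinvariant-genus criterion.  This is the μ-part of Greenberg's conjecture for this field at `p = 2`
and input (a) of `SteinbergFibreAtTwo.NarrowMu.conjA_two_cubicModel_of_narrowMu` for `412992bw1` (input (b) is NOT provided here).  BSD for `412992bw1` is NOT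
proved by this. [cite: Washington1997, §13.3 Prop. 13.22–13.23] [cite: Gras2003, IV.4] [cite: Iwasawa1973MuInvariants, Thm. 2] -/
theorem classicalMuVanishes_h412992bw1
    {θ : AlgebraicClosure ℚ} (hθ : aeval θ (Cubic.toPoly ⟨1, ((0 : ℤ) : ℚ), ((-18 : ℤ) : ℚ), ((-25 : ℤ) : ℚ)⟩) = 0) :
    haveI : FiniteDimensional ℚ (IntermediateField.adjoin ℚ {θ}) :=
      IntermediateField.adjoin.finiteDimensional ((AlgebraicClosure.isAlgebraic ℚ).isAlgebraic θ).isIntegral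
    haveI : NumberField (IntermediateField.adjoin ℚ {θ}) := NumberField.mk
    ∀ κL : ZpExtension (IntermediateField.adjoin ℚ {θ}) 2, κL.IsCyclotomic → ClassicalMuVanishes κL := by
  haveI : FiniteDimensional ℚ (IntermediateField.adjoin ℚ {θ}) :=
    IntermediateField.adjoin.finiteDimensional ((AlgebraicClosure.isAlgebraic ℚ).isAlgebraic θ).isIntegral
  haveI : NumberField (IntermediateField.adjoin ℚ {θ}) := NumberField.mk
  haveI : Fact (Nat.Prime 2) := ⟨Nat.prime_two⟩
  intro κL hκL
  have hirr := irreducible_cubic_disc_6453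
  have h3 := finrank_adjoin_eq_three_of_irreducible hirr hθ
  obtain ⟨B, -, hB⟩ := exists_ringOfIntegers_cubic_root (p := 0) (q := -18) (r := -25) hθ
  have hh1 : NumberField.classNumber (IntermediateField.adjoin ℚ {θ}) = 1 := by
    exact classNumber_eq_one_of_root_disc_6453 (IntermediateField.adjoin ℚ {θ}) h3 B hB
  have hodd : Odd (NumberField.classNumber (IntermediateField.adjoin ℚ {θ})) := by rw [hh1]; exact odd_one
  have htwo := ncard_primes_above_two_le_two (IntermediateField.adjoin ℚ {θ}) h3 B hirr hB ⟨0, by norm_num⟩ ⟨0, by norm_num⟩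
  refine classicalMuVanishes_of_odd_classNumber_of_nonNormUnit_g12 (IntermediateField.adjoin ℚ {θ}) hodd htwo κL (forall_totallyRamifiedFrom_zero_h412992bw1 hθ κL hκL) ?_
  haveI : FiniteDimensional (IntermediateField.adjoin ℚ {θ}) (κL.layer (0 + 1)) := κL.finiteDimensional_layer_holds _
  haveI : FiniteDimensional (IntermediateField.adjoin ℚ {θ}) (κL.layer (0 + (1 + 1))) := κL.finiteDimensional_layer_holds _
  haveI : NumberField (κL.layer (0 + 1)) := NumberField.of_module_finite (IntermediateField.adjoin ℚ {θ}) (κL.layer (0 + 1))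
  haveI : NumberField (κL.layer (0 + (1 + 1))) := NumberField.of_module_finite (IntermediateField.adjoin ℚ {θ}) (κL.layer (0 + (1 + 1)))
  have hML : κL.layer (0 + 1) ≤ κL.layer (0 + (1 + 1)) := κL.layer_mono (by omega)
  letI : Algebra (κL.layer (0 + 1)) (κL.layer (0 + (1 + 1))) := (IntermediateField.inclusion hML).toRingHom.toAlgebra
  haveI : IsScalarTower (IntermediateField.adjoin ℚ {θ}) (κL.layer (0 + 1)) (κL.layer (0 + (1 + 1))) :=
    IsScalarTower.of_algebraMap_eq fun x => ((IntermediateField.inclusion hML).commutes x).symm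
  exact exists_nonNorm_unit_layers_d6453 (IntermediateField.adjoin ℚ {θ}) h3 B hB κL hκL

set_option maxHeartbeats 1600000 in
set_option synthInstance.maxHeartbeats 200000 in
/-- **Classical `μ₂ = 0` along every cyclotomic `ℤ₂`-extension of the cubic point field of `467928d1`** (`θ` any root of
`X³ + (-1)X² + (-102)X + (-342)`, totally real): KERNEL — `h = 1`, `n₀ = 0`, at most two dyadic primes, and the CUBIC non-norm unit of
`exists_nonNorm_unit_layers_d51992`, through the coinvariant-genus criterion.  This is the μ-part of Greenberg's conjecture for this field at `p = 2`
and input (a) of `SteinbergFibreAtTwo.NarrowMu.conjA_two_cubicModel_of_narrowMu` for `467928d1` (input (b) is NOT provided here).  BSD for `467928d1` is NOT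
proved by this. [cite: Washington1997, §13.3 Prop. 13.22–13.23] [cite: Gras2003, IV.4] [cite: Iwasawa1973MuInvariants, Thm. 2] -/
theorem classicalMuVanishes_h467928d1
    {θ : AlgebraicClosure ℚ} (hθ : aeval θ (Cubic.toPoly ⟨1, ((-1 : ℤ) : ℚ), ((-102 : ℤ) : ℚ), ((-342 : ℤ) : ℚ)⟩) = 0) :
    haveI : FiniteDimensional ℚ (IntermediateField.adjoin ℚ {θ}) :=
      IntermediateField.adjoin.finiteDimensional ((AlgebraicClosure.isAlgebraic ℚ).isAlgebraic θ).isIntegral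
    haveI : NumberField (IntermediateField.adjoin ℚ {θ}) := NumberField.mk
    ∀ κL : ZpExtension (IntermediateField.adjoin ℚ {θ}) 2, κL.IsCyclotomic → ClassicalMuVanishes κL := by
  haveI : FiniteDimensional ℚ (IntermediateField.adjoin ℚ {θ}) :=
    IntermediateField.adjoin.finiteDimensional ((AlgebraicClosure.isAlgebraic ℚ).isAlgebraic θ).isIntegral
  haveI : NumberField (IntermediateField.adjoin ℚ {θ}) := NumberField.mk
  haveI : Fact (Nat.Prime 2) := ⟨Nat.prime_two⟩
  intro κL hκL
  have hirr := irreducible_cubic_d51992p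
  have h3 := finrank_adjoin_eq_three_of_irreducible hirr hθ
  obtain ⟨B, -, hB⟩ := exists_ringOfIntegers_cubic_root (p := -1) (q := -102) (r := -342) hθ
  have hh1 : NumberField.classNumber (IntermediateField.adjoin ℚ {θ}) = 1 := by
    -- `b' = (−66 − 7θ + θ²)/3` is a root of the certificate model `X³ − 50X − 104` of the same field
    obtain ⟨b', -, hb'⟩ := exists_intElem_of_scaled_cubic (IntermediateField.adjoin ℚ {θ}) B (-66) (-7) 1 (m := 3) (by norm_num) 0 (-50) (-104)
      (by push_cast; linear_combination ((762 : 𝓞 (IntermediateField.adjoin ℚ {θ})) + (31 : 𝓞 (IntermediateField.adjoin ℚ {θ})) * B + (-20 : 𝓞 (IntermediateField.adjoin ℚ {θ})) * B ^ 2 + (1 : 𝓞 (IntermediateField.adjoin ℚ {θ})) * B ^ 3) * hB)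
    exact classNumber_eq_one_of_root_d51992p (IntermediateField.adjoin ℚ {θ}) h3 b' hb'
  have hodd : Odd (NumberField.classNumber (IntermediateField.adjoin ℚ {θ})) := by rw [hh1]; exact odd_one
  have htwo := ncard_primes_above_two_le_two (IntermediateField.adjoin ℚ {θ}) h3 B hirr hB ⟨0, by norm_num⟩ ⟨1, by norm_num⟩
  refine classicalMuVanishes_of_odd_classNumber_of_nonNormUnit_g12 (IntermediateField.adjoin ℚ {θ}) hodd htwo κL (forall_totallyRamifiedFrom_zero_h467928d1 hθ κL hκL) ?_
  haveI : FiniteDimensional (IntermediateField.adjoin ℚ {θ}) (κL.layer (0 + 1)) := κL.finiteDimensional_layer_holds _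
  haveI : FiniteDimensional (IntermediateField.adjoin ℚ {θ}) (κL.layer (0 + (1 + 1))) := κL.finiteDimensional_layer_holds _
  haveI : NumberField (κL.layer (0 + 1)) := NumberField.of_module_finite (IntermediateField.adjoin ℚ {θ}) (κL.layer (0 + 1))
  haveI : NumberField (κL.layer (0 + (1 + 1))) := NumberField.of_module_finite (IntermediateField.adjoin ℚ {θ}) (κL.layer (0 + (1 + 1)))
  have hML : κL.layer (0 + 1) ≤ κL.layer (0 + (1 + 1)) := κL.layer_mono (by omega)
  letI : Algebra (κL.layer (0 + 1)) (κL.layer (0 + (1 + 1))) := (IntermediateField.inclusion hML).toRingHom.toAlgebra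
  haveI : IsScalarTower (IntermediateField.adjoin ℚ {θ}) (κL.layer (0 + 1)) (κL.layer (0 + (1 + 1))) :=
    IsScalarTower.of_algebraMap_eq fun x => ((IntermediateField.inclusion hML).commutes x).symm
  exact exists_nonNorm_unit_layers_d51992 (IntermediateField.adjoin ℚ {θ}) h3 B hB κL hκL

end Summit.BirchSwinnertonDyer.BirchSwinnertonDyer.Theorems.AddKatoTwo

end
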